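import Summits.QuantumFields.YangMills.Theorems.LuscherReductionTwistedTraceScalingCoarseTailGlue
import Summits.QuantumFields.YangMills.Theorems.LuscherReductionRunningReductionBOHandover
import Summits.QuantumFields.YangMills.Theorems.LuscherReductionRunningReductionOneSiteTailClosed
import Summits.QuantumFields.YangMills.Theorems.LuscherReductionOneSiteLevelsClosed
import HarnessLib

/-!
# S-BASE at `L₁ = 1`, UNCONDITIONAL: the fixed-lattice trace law of the one-site model in the route's running-coupling parametrisation
# — the end-to-end check of the cut S-BASE ⇐ COARSE-UPPER + COARSE-LOWER + W at the one lattice size where all three inputs are tree theorems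
# (route `LuscherReduction`, crux `TwistedTraceScaling` stmt-QuantumFields-20203, stub `stub_fixedLatticeTraceLaw`; card
# `pub/ym-fleet/ym-luscher-20007-p1/Lines-base-coarse-cut.md`)

At `L₁ = 1` the three open inputs of the endorsed cut are consequences of CLOSED items: COARSE-UPPER(1) and COARSE-LOWER(1) from crux ONE
(`oneSiteLevels_proof`, stmt-QuantumFields-20007) through the Born–Oppenheimer handover at `L₀ = 1`, where the comparison `BO(1)` of the
`1³`-lattice with the one-site model at coupling `1³β` is TRIVIAL (`BOHandover.coarseNoIntruderAt_of_boUpper`, `coarseLowerAt_of_boLower`, g3);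
and the window floor W(1) from the `B`-uniform window floor of the closed child `OneSiteTail` (`OST.windowFloor_all`, stmt-QuantumFields-20204,
g4) with the label comparison `Λ(β,1) ≤ 2λ_b(β)` (`BOHandover.exists_luscherLambda_le_mul_bareLambda`).  Feeding them to
`Base.fixedLatticeTraceLaw_of_upper_lower_window 1` (p528251) gives

  ★ `fixedLatticeTraceLaw_one : ∀ s > 0, ∀ ε > 0, ∃ β₁, ∀ β ≥ β₁, |traceRatio 1 β (femtoSteps s β 1) − hTraceRatio s| ≤ ε`

— the `L₁ = 1` instance of `Stmt.stub_fixedLatticeTraceLaw`, i.e. the one-site zero-flux dyadic TRACE ratio (`physTrace`, not levels) at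
`T = ⌈s/Λ(β,1)⌉` transfer steps (two-loop label `Λ(β,1)`, not `λ_b = (2/β)^{1/3}`) tends to Lüscher's `r_𝔥(s)` as `β → ∞`.  New relative to
`TraceDoor.oneSiteTraceLimit` (OSTL): trace currency and the running label; it certifies that the glue chain
(BaseWindow → BaseOfCoarse → LatticeHS → CoarseTailGlue) closes the stub wherever COARSE-UPPER/LOWER/W are available.
HONEST FRAMING: one-site (`L = 1`) lattice quantum mechanics; S-BASE for `L₁ ≥ 2` remains OPEN (needs the lattice semiclassics C2–C4);
not RG, not a gap, not Clay.
-/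

set_option autoImplicit false

noncomputable section

open MeasureTheory Filter Topology Real
open Literature.MathematicalPhysics.QuantumFieldTheory hiding SU2
open Literature.MathematicalPhysics.QuantumLattice
open Literature.Analysis.OperatorTheory.YMMatrixModel
open scoped BigOperators

namespace Summit.QuantumFields.YangMills.Theorems.FemtoTransferGap.TwoLattice

open Summit.QuantumFields.YangMills.Theorems.FemtoTransferGap
open Summit.QuantumFields.YangMills.Theorems.FemtoTransferGap.TraceDoor

namespace Base

/-! ## §1 `BO(1)` is trivial: the `1³` lattice IS the one-site model at coupling `1³β = β` -/

/-- `BO_upper(1)`: `λ_k(1,β)·μ₀(1³β) ≤ e^{ελ_b(1³β)}·μ_k(1³β)·λ₀(1,β)` — both sides are the same one-site values (`1³β = β`, `e^{ελ_b} ≥ 1`).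
[folklore] -/
theorem boUpper_one : ∀ k : ℕ, ∀ ε : ℝ, 0 < ε → ∃ β0 : ℝ, ∀ β : ℝ, β0 ≤ β →
    levelValue su2Rep 1 β k * levelValue su2Rep 1 (((1 : ℕ) : ℝ) ^ 3 * β) 0 ≤
      Real.exp (ε * bareLambda (((1 : ℕ) : ℝ) ^ 3 * β)) *
        (levelValue su2Rep 1 (((1 : ℕ) : ℝ) ^ 3 * β) k * levelValue su2Rep 1 β 0) := by
  intro k ε hε
  refine ⟨1, fun β hβ => ?_⟩
  have hβ0 : 0 < β := by linarith
  simp only [Nat.cast_one, one_pow, one_mul]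
  have hx : 0 ≤ levelValue su2Rep 1 β k * levelValue su2Rep 1 β 0 :=
    mul_nonneg (levelValue_su2Rep_nonneg 1 hβ0.le k) (levelValue_su2Rep_nonneg 1 hβ0.le 0)
  have he : 1 ≤ Real.exp (ε * bareLambda β) := Real.one_le_exp (mul_nonneg hε.le (bareLambda_pos' hβ0).le)
  calc levelValue su2Rep 1 β k * levelValue su2Rep 1 β 0 = 1 * (levelValue su2Rep 1 β k * levelValue su2Rep 1 β 0) := (one_mul _).symm
    _ ≤ Real.exp (ε * bareLambda β) * (levelValue su2Rep 1 β k * levelValue su2Rep 1 β 0) := mul_le_mul_of_nonneg_right he hx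

/-- `BO_lower(1)`: the converse trivial comparison. [folklore] -/
theorem boLower_one : ∀ k : ℕ, ∀ ε : ℝ, 0 < ε → ∃ β0 : ℝ, ∀ β : ℝ, β0 ≤ β →
    levelValue su2Rep 1 (((1 : ℕ) : ℝ) ^ 3 * β) k * levelValue su2Rep 1 β 0 ≤
      Real.exp (ε * bareLambda (((1 : ℕ) : ℝ) ^ 3 * β)) *
        (levelValue su2Rep 1 β k * levelValue su2Rep 1 (((1 : ℕ) : ℝ) ^ 3 * β) 0) := by
  intro k ε hε
  refine ⟨1, fun β hβ => ?_⟩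
  have hβ0 : 0 < β := by linarith
  simp only [Nat.cast_one, one_pow, one_mul]
  have hx : 0 ≤ levelValue su2Rep 1 β k * levelValue su2Rep 1 β 0 :=
    mul_nonneg (levelValue_su2Rep_nonneg 1 hβ0.le k) (levelValue_su2Rep_nonneg 1 hβ0.le 0)
  have he : 1 ≤ Real.exp (ε * bareLambda β) := Real.one_le_exp (mul_nonneg hε.le (bareLambda_pos' hβ0).le)
  calc levelValue su2Rep 1 β k * levelValue su2Rep 1 β 0 = 1 * (levelValue su2Rep 1 β k * levelValue su2Rep 1 β 0) := (one_mul _).symm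
    _ ≤ Real.exp (ε * bareLambda β) * (levelValue su2Rep 1 β k * levelValue su2Rep 1 β 0) := mul_le_mul_of_nonneg_right he hx

/-! ## §2 The three inputs of the cut at `L₁ = 1` are tree theorems -/

/-- **COARSE-UPPER(1)** (= `CoarseNoIntruderAt 1` of KTR): from crux ONE through the trivial `BO(1)`. [cite: Luscher1983, §3] -/
theorem coarseUpper_one : ∀ k : ℕ, ∀ d : ℝ, d < levelGap k → ∃ lam0 : ℝ, 0 < lam0 ∧ ∀ lam : ℝ, 0 < lam → lam ≤ lam0 →
    ∀ β : ℝ, InFemtoWindow lam β 1 →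
      levelValue su2Rep 1 β k ≤ Real.exp (-(d * luscherLambda β 1) / (1 : ℕ)) * levelValue su2Rep 1 β 0 :=
  BOHandover.coarseNoIntruderAt_of_boUpper 1 boUpper_one oneSiteLevels_proof

/-- **COARSE-LOWER(1)** (= `CoarseLowerAt 1` of KTR): from crux ONE through the trivial `BO(1)`. [cite: Luscher1983, §3] -/
theorem coarseLower_one : ∀ k : ℕ, ∀ ε : ℝ, 0 < ε → ∃ lam0 : ℝ, 0 < lam0 ∧ ∀ lam : ℝ, 0 < lam → lam ≤ lam0 →
    ∀ β : ℝ, InFemtoWindow lam β 1 →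
      Real.exp (-((levelGap k + ε) * luscherLambda β 1) / (1 : ℕ)) * levelValue su2Rep 1 β 0 ≤ levelValue su2Rep 1 β k :=
  BOHandover.coarseLowerAt_of_boLower 1 boLower_one oneSiteLevels_proof

/-- **W(1)**, the window floor at `L₁ = 1` in the running label `u = Λ(β,1)/1`: from the closed child's `OST.windowFloor_all`
(profile halved, cap `2c₁`) and `Λ(β,1) ≤ 2λ_b(β)` eventually. [cite: Luscher1983, §3] [cite: LuscherMunster1984, §2] -/
theorem window_one : ∀ c₁ : ℝ, 0 < c₁ → ∃ g : ℕ → ℝ, (∀ k, 0 ≤ g k) ∧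
    (∀ t : ℝ, 0 < t → Summable fun k : ℕ => Real.exp (-t * g k)) ∧
    ∃ β0 : ℝ, ∀ β : ℝ, β0 ≤ β → ∀ k : ℕ,
      levelValue su2Rep 1 β k ≤
        Real.exp (-(luscherLambda β 1 / (1 : ℕ) * min (g k) (c₁ * Real.log β))) * levelValue su2Rep 1 β 0 := by
  intro c₁ hc₁
  obtain ⟨g, hg0, hgsum, B0, hfloor⟩ := OST.windowFloor_all (2 * c₁) (by positivity)
  -- label comparison: Λ(β,1) ≤ 2 λ_b(β) for large β
  obtain ⟨β₁, hlab⟩ := BOHandover.exists_luscherLambda_le_mul_bareLambda 1 (η := 1) one_pos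
  obtain ⟨β₂, hwin⟩ := exists_window_of_large_beta 1 (lam0 := 1) one_pos
  refine ⟨fun k => g k / 2, fun k => by have := hg0 k; positivity, fun t ht => ?_, max (max B0 β₁) (max β₂ 1), fun β hβ k => ?_⟩
  · have h := hgsum (t / 2) (by positivity)
    refine h.congr fun k => ?_
    congr 1; ring
  have hB0 : B0 ≤ β := le_trans ((le_max_left _ _).trans (le_max_left _ _)) hβ
  have hβ₁ : β₁ ≤ β := le_trans ((le_max_right _ _).trans (le_max_left _ _)) hβ
  have hβ₂ : β₂ ≤ β := le_trans ((le_max_left _ _).trans (le_max_right _ _)) hβ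
  have hβone : 1 ≤ β := le_trans ((le_max_right _ _).trans (le_max_right _ _)) hβ
  have hβ0 : 0 < β := by linarith
  obtain ⟨lam, hlam, -, hW⟩ := hwin β hβ₂
  have hΛpos : 0 < luscherLambda β 1 := luscherLambda_pos_of_window hlam hW
  have hΛ : luscherLambda β 1 ≤ 2 * bareLambda β := by
    have h := hlab β hβ₁ hΛpos
    simp only [Nat.cast_one, one_pow, one_mul] at h
    linarith
  have hlb : 0 ≤ bareLambda β := (bareLambda_pos' hβ0).le
  have hlog : 0 ≤ Real.log β := Real.log_nonneg hβone
  have hm0 : 0 ≤ min (g k) (2 * c₁ * Real.log β) := le_min (hg0 k) (by positivity)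
  have hmin : min (g k / 2) (c₁ * Real.log β) = min (g k) (2 * c₁ * Real.log β) / 2 := by
    rcases le_total (g k) (2 * c₁ * Real.log β) with h | h
    · rw [min_eq_left h, min_eq_left (by linarith)]
    · rw [min_eq_right h, min_eq_right (by linarith)]; ring
  have h0pos : 0 < levelValue su2Rep 1 β 0 := levelValue_zero_su2Rep_pos 1 β
  refine (hfloor β hB0 k).trans (mul_le_mul_of_nonneg_right (Real.exp_le_exp.2 ?_) h0pos.le)
  -- `−λ_b·m ≤ −(Λ/1)·(m/2)` since `Λ ≤ 2λ_b` and `m ≥ 0`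
  rw [Nat.cast_one, div_one, hmin, neg_le_neg_iff]
  have := mul_le_mul_of_nonneg_right hΛ hm0
  nlinarith

/-! ## §3 S-BASE at `L₁ = 1`, unconditional -/

/-- ★ **The fixed-lattice trace law at `L₁ = 1` (S-BASE's one-site instance), UNCONDITIONAL**: for every `s > 0`, `ε > 0` there is `β₁` with
`|traceRatio 1 β (femtoSteps s β 1) − hTraceRatio s| ≤ ε` for all `β ≥ β₁` — the zero-flux dyadic trace ratio of the one-site three-matrix
`SU(2)` model at `T = ⌈s/Λ(β,1)⌉` transfer steps tends to Lüscher's `r_𝔥(s)`.  Inputs: ONE (20007), `OneSiteTail`'s window floor (20204),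
`TraceFormula`, and this lineage's cut/glue. [cite: Luscher1983, §3] [cite: MontvayMunster1994, (3.145)] -/
theorem fixedLatticeTraceLaw_one : ∀ s : ℝ, 0 < s → ∀ ε : ℝ, 0 < ε → ∃ β1 : ℝ, ∀ β : ℝ, β1 ≤ β →
    |traceRatio 1 β (femtoSteps s β 1) - hTraceRatio s| ≤ ε :=
  fixedLatticeTraceLaw_of_upper_lower_window 1 coarseUpper_one coarseLower_one window_one

end Base

end Summit.QuantumFields.YangMills.Theorems.FemtoTransferGap.TwoLattice

end
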